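import Summits.BirchSwinnertonDyer.BirchSwinnertonDyer.Theorems.PrintCf2RubinValueTwoColemanCoinvariantCharPrincipal
import Literature.NumberTheory.EllipticCurves.PAdicTwoVariableColemanImageCocycleOfUnitsGalois
import HarnessLib

/-!
# Brick (c) at `p = 2`, local `χ`-part, for families indexed by ARBITRARY Galois elements (the true Artin symbols):
# **`char_Λ ((N / Col 𝒞̄)_ε) = (L_ε)`** with `φ_ε(Col β_c) = (t_{χ(σ̃_c)}·g_{σ̃_c} − N_c)·L_ε` — the «`σ̃_c` fixes `E_∞`» hypothesis of the closure /
# generated / principal forms REMOVED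

Cell `bsd-print-cf2`, width seat `bsd-line-cf2c-w7` g14, route C `PrintCf2RubinValueTwo`, crux of record stmt-BirchSwinnertonDyer-24033
`TwoVariableMainConjAtSplitTwoQuad` (23720 nominal), BRICK §4(c); `--supports` the crux as a helper.  THEOREMS ONLY (0 sorry, no named fact, no
`def … : Prop`); Theses-free.  BSD is not proved by any of this.

The closure form (g13 S17), generated form (S18b) and principal form (g14 S19) of the local (c)-identity take the indices `σ̃_c ∈ Γ_F` of the unit
relation II §2.4 (ii) to FIX the unramified tower `E_∞` (`hσE`), so that `Col(σ̃β) = σ_{χ(σ̃)} Col β`.  In the two-variable frame the indices are local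
lifts of GLOBAL Artin symbols `(𝔞, K(𝔤p^∞)/K)`, which never fix `K(𝔤𝔭̄^∞)` for `𝔞 ≠ 1` (de Shalit II §4.14 Step 1: `μ_𝔞 = 12(σ_𝔞 − N𝔞)μ` with the
true `σ_𝔞`).  With `colemanImage_galAct` (`Col(σ̃β) = σ_{χ(σ̃)}(C g_{σ̃} • Col β)`, `g_{σ̃}` the Amice element of `σ̃|_{E_∞}`), the division at a general
point of `𝔪_{𝒪⟦X⟧} = (π, X)` (`LubinTateColemanCoordCoinvariantDivisionMaximalTwo`) and the Galois cocycle (`PAdicTwoVariableColemanImageCocycleOfUnitsGalois`),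
THIS file proves the identity for such families:

* §1 (any base) `map_span_range_eq_of_forall_eq_mul`, ★ `charIdeal_colemanCoinvariants_eq_of_sandwich_of_isPseudoNull` — the sandwich with an
  ARBITRARY factor family `f` and the pseudo-nullity of `Λ/(f_c : c)` as hypothesis;
* §2 (complete local domain base) ★ `isPseudoNull_quotient_span_twistFactors` — `Λ/J̃_ε` is pseudo-null for `J̃_ε = (t_{v c}·C g_c − C n_c : c)` from
  `v a₁ = γ` (so `f_{a₁} = C g_{a₁}·(T − b)`, `b = n_{a₁} g_{a₁}⁻¹ − 1 ∈ 𝔪`, `T − b` prime) and ONE `a₂` with non-zero Weierstrass value at `b`;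
* §3 (`Λ = 𝒪_F⟦X⟧⟦T⟧`, `d = 1`, closed `Γ_F`-stable `C ⊆ closure ⟨β_c^{±1}⟩`) `map_colemanImageSubmodule₁_le_of_galois` (`φ_ε(Col C) ≤ (L)·J̃_ε`),
  ★★★ **`charIdeal_coinvariants_colemanImage_eq_span_of_galois`** — **`char_Λ ((N / Col C)_ε) = (L_ε)`** for Galois-indexed families, and
  ★★ `exists_charIdeal_coinvariants_colemanImage_eq_span_of_galois` (`L_ε` from the levelwise relation via the Galois cocycle);
* §4 ★★★ `charIdeal_coinvariants_colemanImage_closure_eq_span_of_galois` / `exists_…` — the generated form `𝒞̄ = closure ⟨β_c^{±1}⟩`.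

Remaining named inputs for de Shalit III (17) / Yager at one prime above `2`: the two-variable elliptic-unit families `β_𝔞 ∈ 𝒰¹_∞` with the
levelwise relation for local lifts `σ̃_𝔞` of the Artin symbols and their Amice pairs, the translates `σ̃·β_𝔞 ∈ 𝒞̄` (II §2.4 (ii) + density), `L_ε ≠ 0`
(one non-zero Coates–Wiles moment, `LubinTateColemanCoordCoinvariantNonvanishingTwo`).

## References
* [deShalit1987] E. de Shalit, *Iwasawa theory of elliptic curves with complex multiplication* (1987), I §3.4, §3.8 (17); II §2.4 (ii), §4.12 (29)–(33),
  §4.14; III §1.1, §1.4 (5), Cor. 1.5 (7), Lemma 1.10 (17).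
* [Washington1997] L. C. Washington, *Introduction to Cyclotomic Fields* (1997), §7.1, §13.2.
* [Matsumura1987] H. Matsumura, *Commutative Ring Theory* (1986), Thm. 20.3.
-/

noncomputable section

set_option linter.dupNamespace false
set_option autoImplicit false

open Filter Topology
open scoped PowerSeries.WithPiTopology

namespace Summit.BirchSwinnertonDyer.BirchSwinnertonDyer.Theorems.PrintCf2.ColemanCoinvariantGalois

open Literature.NumberTheory.GaloisRepresentations Literature.NumberTheory.GaloisRepresentations.IsNonarchimedeanLocalField
  Literature.NumberTheory.GaloisRepresentations.LubinTate ValuativeRel Field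
open Literature.NumberTheory.EllipticCurves
open Literature.RingTheory.PowerSeries (maxEval)
open Summit.BirchSwinnertonDyer.BirchSwinnertonDyer.Theorems.PrintCf2.SemilocalColeman
open Summit.BirchSwinnertonDyer.BirchSwinnertonDyer.Theorems.PrintCf2.ColemanCoinvariantSeries
open Summit.BirchSwinnertonDyer.BirchSwinnertonDyer.Theorems.PrintCf2.ColemanImage
open Summit.BirchSwinnertonDyer.BirchSwinnertonDyer.Theorems.PrintCf2.ColemanCoinvariantClosure
open Summit.BirchSwinnertonDyer.BirchSwinnertonDyer.Theorems.PrintCf2.ColemanCoinvariantPrincipal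

variable {F : Type} [Field F] [ValuativeRel F] [TopologicalSpace F] [IsNonarchimedeanLocalField F]

attribute [local instance] ltNormUniformSpace ltNormIsUniformAddGroup rk1 nF nE fintypeResidueField

/-! ## §1. The sandwich with an arbitrary factor family -/

section Sandwich

variable {π : 𝒪[F]} (hπ : (valuation F).IsUniformizer (π : F)) (hq : residueFieldCard F = 2)
variable {S : Type*} [CommRing S] (ι : LTCoeff F →+* S) [IsAdicComplete (Ideal.span {ι (LTCoeff.of F π)}) S]
variable (u : (LTCoeff F)ˣ) (hu : LTCoeff.of F π = residueFieldCard F * u) (γ : 𝒪[F]ˣ)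
variable (hreg : ∀ s : S, ι (LTCoeff.of F π) * s = 0 → s = 0) (w : 𝒪[F]ˣ) (hγ : (γ : 𝒪[F]) = 1 + π ^ 2 * w)
variable (ε : PowerSeries S) (hε : ε * ε = 1)

/-- `φ_ε(Λ·span{x c}) = (L)·(f_c : c)` whenever `φ_ε(x c) = f_c·L` for every `c`. [cite: deShalit1987, III §1.4 (5)] -/
theorem map_span_range_eq_of_forall_eq_mul {I : Type*} (x : I → ColemanCoordModule hπ hq ι u hu γ) (f : I → PowerSeries S) (L : PowerSeries S)
    (hL : ∀ c : I, colemanDeltaCoinvFun hπ hq ι u hu γ hreg w hγ ε (x c) = f c * L) :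
    (Submodule.span (PowerSeries S) (Set.range x)).map (colemanDeltaCoinvFun hπ hq ι u hu γ hreg w hγ ε) =
      Ideal.span {L} * Ideal.span (Set.range f) := by
  have hfun : (⇑(colemanDeltaCoinvFun hπ hq ι u hu γ hreg w hγ ε) ∘ x) = fun c => f c * L := funext fun c => hL c
  rw [Submodule.map_span, ← Set.range_comp, hfun]
  exact span_range_mul_eq_span_singleton_mul f L

variable [IsDomain S] [IsNoetherianRing S]

include hε in
/-- ★ **The sandwich with an arbitrary factor family**: `φ_ε(x c) = f_c·L` (`L ≠ 0`), `Λ/(f_c : c)` pseudo-null, `Λ·span{x c} ≤ N′ ≤ N₀`,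
`φ_ε(N′) ≤ (L)·(f_c : c)`, `σ_{−1}N₀ ≤ N₀`, `M/N₀` pseudo-null ⟹ **`char_Λ ((N₀/N′)_ε) = char_Λ (Λ/(L))`**.
[cite: deShalit1987, III §1.4 (5), Cor. 1.5 (7), Lemma 1.10 (17)] [cite: Washington1997, §13.2] -/
theorem charIdeal_colemanCoinvariants_eq_of_sandwich_of_isPseudoNull {I : Type*} (x : I → ColemanCoordModule hπ hq ι u hu γ)
    (f : I → PowerSeries S) (L : PowerSeries S) (hL0 : L ≠ 0)
    (hL : ∀ c : I, colemanDeltaCoinvFun hπ hq ι u hu γ hreg w hγ ε (x c) = f c * L)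
    (hJ : Module.IsPseudoNull (PowerSeries S) (PowerSeries S ⧸ Ideal.span (Set.range f)))
    (N' N₀ : Submodule (PowerSeries S) (ColemanCoordModule hπ hq ι u hu γ)) (hxN' : Submodule.span (PowerSeries S) (Set.range x) ≤ N')
    (hN'L : N'.map (colemanDeltaCoinvFun hπ hq ι u hu γ hreg w hγ ε) ≤ Ideal.span {L} * Ideal.span (Set.range f))
    (hN'N₀ : N' ≤ N₀) (hN₀ : ∀ n ∈ N₀, unitTwistₗ hπ hq ι u hu γ (-1) n ∈ N₀)
    (hMN₀ : Module.IsPseudoNull (PowerSeries S) (ColemanCoordModule hπ hq ι u hu γ ⧸ N₀)) :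
    Module.charIdeal (PowerSeries S) (N₀ ⧸ colemanCoinvRel hπ hq ι u hu γ ε N₀ hN₀ N') =
      Module.charIdeal (PowerSeries S) (PowerSeries S ⧸ Ideal.span {L}) := by
  rw [charIdeal_colemanCoinvariants_eq hπ hq ι u hu γ hreg w hγ ε hε N₀ hN₀ N' hN'N₀ hMN₀]
  have hmap : N'.map (colemanDeltaCoinvFun hπ hq ι u hu γ hreg w hγ ε) = Ideal.span {L} * Ideal.span (Set.range f) := by
    refine le_antisymm hN'L ?_
    rw [← map_span_range_eq_of_forall_eq_mul hπ hq ι u hu γ hreg w hγ ε x f L hL]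
    exact Submodule.map_mono hxN'
  have e : (PowerSeries S ⧸ N'.map (colemanDeltaCoinvFun hπ hq ι u hu γ hreg w hγ ε)) ≃ₗ[PowerSeries S]
      (PowerSeries S ⧸ Ideal.span {L} * Ideal.span (Set.range f)) :=
    Submodule.quotEquivOfEq _ _ hmap
  rw [charIdeal_eq_of_linearEquiv e]
  exact charIdeal_quotient_span_singleton_mul_eq hL0 hJ

end Sandwich

/-! ## §2. `Λ/J̃_ε` is pseudo-null for the twisted factors -/

section PseudoNull

variable {π : 𝒪[F]} (hπ : (valuation F).IsUniformizer (π : F)) (hq : residueFieldCard F = 2)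
variable {S : Type*} [CommRing S] (ι : LTCoeff F →+* S) [IsAdicComplete (Ideal.span {ι (LTCoeff.of F π)}) S]
variable (u : (LTCoeff F)ˣ) (hu : LTCoeff.of F π = residueFieldCard F * u) (γ : 𝒪[F]ˣ)
variable (hreg : ∀ s : S, ι (LTCoeff.of F π) * s = 0 → s = 0) (w : 𝒪[F]ˣ) (hγ : (γ : 𝒪[F]) = 1 + π ^ 2 * w)
variable (ε : PowerSeries S)
variable [IsLocalRing S] [IsAdicComplete (IsLocalRing.maximalIdeal S) S] [IsDomain S] [IsNoetherianRing S]

/-- ★ **`Λ/J̃_ε` is pseudo-null**, `J̃_ε = (t_{v c}·C g_c − C n_c : c)`: the index `a₁` (`v a₁ = γ`) contributes `C g_{a₁}·(T − b)` with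
`b = n_{a₁} g_{a₁}⁻¹ − 1 ∈ 𝔪_S`, so the prime `T − b` lies in `J̃_ε`, and the index `a₂` an element with non-zero Weierstrass value at `b`, not divisible by
`T − b` (de Shalit: "two relatively prime elements"). [cite: deShalit1987, III Lemma 1.10 (proof, p. 96); II §4.12 (29)–(32)] [cite: Washington1997, §7.1] -/
theorem isPseudoNull_quotient_span_twistFactors {I : Type*} (v : I → 𝒪[F]ˣ) (g : I → Sˣ) (n : I → S)
    (a₁ a₂ : I) (hv₁ : v a₁ = γ) (hn₁ : n a₁ * ((g a₁)⁻¹ : Sˣ) - 1 ∈ IsLocalRing.maximalIdeal S)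
    (ha₂ : maxEval hn₁ (colemanDeltaCoinvFun hπ hq ι u hu γ hreg w hγ ε
        (unitTwistₗ hπ hq ι u hu γ (v a₂) (TActModule.ofPS _ _ 1)) - PowerSeries.C (n a₂ * ((g a₂)⁻¹ : Sˣ))) ≠ 0) :
    Module.IsPseudoNull (PowerSeries S) (PowerSeries S ⧸ Ideal.span (Set.range fun c =>
      colemanDeltaCoinvFun hπ hq ι u hu γ hreg w hγ ε (unitTwistₗ hπ hq ι u hu γ (v c) (TActModule.ofPS _ _ 1)) *
        PowerSeries.C (g c : S) - PowerSeries.C (n c))) := by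
  set J : Ideal (PowerSeries S) := Ideal.span (Set.range fun c =>
      colemanDeltaCoinvFun hπ hq ι u hu γ hreg w hγ ε (unitTwistₗ hπ hq ι u hu γ (v c) (TActModule.ofPS _ _ 1)) *
        PowerSeries.C (g c : S) - PowerSeries.C (n c)) with hJ
  have hmem : ∀ c, colemanDeltaCoinvFun hπ hq ι u hu γ hreg w hγ ε (unitTwistₗ hπ hq ι u hu γ (v c) (TActModule.ofPS _ _ 1)) *
      PowerSeries.C (g c : S) - PowerSeries.C (n c) ∈ J := fun c => Ideal.subset_span ⟨c, rfl⟩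
  -- the factor at `a₁` is `C g₁ · (T − b)`
  have e₁ : colemanDeltaCoinvFun hπ hq ι u hu γ hreg w hγ ε (unitTwistₗ hπ hq ι u hu γ (v a₁) (TActModule.ofPS _ _ 1)) *
        PowerSeries.C (g a₁ : S) - PowerSeries.C (n a₁) =
      (PowerSeries.X - PowerSeries.C (n a₁ * ((g a₁)⁻¹ : Sˣ) - 1)) * PowerSeries.C (g a₁ : S) := by
    rw [← sub_C_mul_inv_mul_C g n _ a₁, hv₁, colemanDeltaCoinvFun_unitTwistₗ_self_one_sub_C, one_mul]
  have hp₀J : PowerSeries.X - PowerSeries.C (n a₁ * ((g a₁)⁻¹ : Sˣ) - 1) ∈ J := by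
    have h := J.mul_mem_right (PowerSeries.C (((g a₁)⁻¹ : Sˣ) : S)) (hmem a₁)
    rwa [e₁, mul_assoc, ← map_mul, Units.mul_inv, map_one, mul_one] at h
  refine isPseudoNull_quotient_of_prime_mem (Literature.RingTheory.PowerSeries.prime_X_sub_C hn₁) hp₀J (hmem a₂) fun hdvd => ha₂ ?_
  -- `(T − b) ∣ f_{a₂} = (t₂ − C(n₂ g₂⁻¹))·C g₂` forces the Weierstrass value of `t₂ − C(n₂ g₂⁻¹)` to vanish
  rw [← sub_C_mul_inv_mul_C g n _ a₂, Literature.RingTheory.PowerSeries.X_sub_C_dvd_iff_maxEval_eq_zero hn₁,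
    Literature.RingTheory.PowerSeries.maxEval_mul, Literature.RingTheory.PowerSeries.maxEval_C] at hdvd
  exact (mul_eq_zero.mp hdvd).resolve_right (Units.ne_zero (g a₂))

end PseudoNull

/-! ## §3. The local (c)-identity for Galois-indexed families, closure form -/

section Galois

attribute [local instance] RelNormCoherentUnits.instCommMonoid
attribute [local instance] isAdicComplete_maximalIdeal_powerSeries_integer

variable {p : ℕ} [hp : Fact p.Prime] {d : ℕ} (hd : d.Coprime p)
variable {π : 𝒪[F]} (hπ : (valuation F).IsUniformizer (π : F))
variable (E : ℕ → IntermediateField F (AlgebraicClosure F)) [∀ m, FiniteDimensional F (E m)] [∀ m, Normal F (E m)]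
  [∀ m, IsGalois F (E m)] (hmono : Monotone E) (hE : ∀ m, E m ≤ maxUnramified F) (hdeg : ∀ m, Module.finrank F (E m) = d * p ^ m)
  {σ₀ : absoluteGaloisGroup F} (hσ₀ : IsAbsArithFrob σ₀) (hq : residueFieldCard F = 2)
variable (u : (LTCoeff F)ˣ) (hu : LTCoeff.of F π = residueFieldCard F * u) (γ w : 𝒪[F]ˣ) (hγ : (γ : 𝒪[F]) = 1 + π ^ 2 * w)
variable [IsAdicComplete (Ideal.span {intBase F (LTCoeff.of F π)}) (PowerSeries 𝒪[F])] [NeZero d]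
variable {θ : ∀ m, unitBall (E m)} (hθ : ∀ m, IsIntegralNormalGen (E m) (θ m))
  (hcoh : ∀ m, unitBallTrace (hmono (Nat.le_succ m)) (θ (m + 1)) = θ m)
variable [CharZero F] [IsAdicComplete (Ideal.span {(p : 𝒪[F])}) 𝒪[F]] (hI : Ideal.span {(p : 𝒪[F])} ≠ ⊤)
  (hud : ∀ m, (u : LTCoeff F) ^ Module.finrank F (E m) ≠ 1) (hm : ∃ m₁ : ℕ, LTCoeff.of F π ^ 2 ∣ LTCoeff.of F π - m₁)
variable [Unique (ZMod d)] (hN : DenseRange (Nat.cast : ℕ → 𝒪[F]))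
  (C : Set (∀ m, RelNormCoherentUnits hπ (E m))) (hC : IsClosed C) (hCsub : C ⊆ principalCoherentFamilies hπ E hmono)
  (h1 : (fun m => (RelNormCoherentUnits.one : RelNormCoherentUnits hπ (E m))) ∈ C)
  (hmul : ∀ β ∈ C, ∀ β' ∈ C, (fun m => (β m).mul (β' m)) ∈ C) (hinv : ∀ β ∈ C, (fun m => (β m).inv hπ (E m)) ∈ C)
  (hgal : ∀ σ : absoluteGaloisGroup F, ∀ β ∈ C, (fun m => (β m).galAct σ) ∈ C)
variable {I : Type*} (β : I → ∀ m, RelNormCoherentUnits hπ (E m)) (hβC : ∀ c, β c ∈ C)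
variable (ε : PowerSeries (PowerSeries 𝒪[F])) (σ : I → absoluteGaloisGroup F) (g : I → (PowerSeries 𝒪[F])ˣ) (n : I → ℕ)

omit [CharZero F] in
include hdeg h1 hmul hinv hβC in
/-- **`φ_ε(Col C) ≤ (L)·J̃_ε`** (`J̃_ε = (t_{χ(σ̃_c)}·C g_c − C n_c : c)`) from `φ_ε(Col β_c) = (t_{χ(σ̃_c)}·C g_c − C n_c)·L` and `C ⊆ closure ⟨β_c^{±1}⟩`
(`φ_ε`, `Col` continuous; ideals of the compact Noetherian `Λ` closed). [cite: deShalit1987, III §1.4 (5)] [cite: Washington1997, §13.2] -/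
theorem map_colemanImageSubmodule₁_le_of_galois
    (hCgen : C ⊆ closure (Submonoid.closure (Set.range β ∪ Set.range fun c => fun m => ((β c) m).inv hπ (E m)) : Set _))
    (L : PowerSeries (PowerSeries 𝒪[F]))
    (hL : ∀ c : I, colemanDeltaCoinvFun hπ hq (intBase F) u hu γ (eq_zero_of_C_pi_mul_eq_zero_integer hπ) w hγ ε
        (colemanImage hd hπ E hmono hE hdeg hσ₀ hq u hu γ hθ hcoh (hCsub (hβC c)).1 default) =
      (colemanDeltaCoinvFun hπ hq (intBase F) u hu γ (eq_zero_of_C_pi_mul_eq_zero_integer hπ) w hγ ε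
          (unitTwistₗ hπ hq (intBase F) u hu γ (lubinTateChar hπ (σ c)) (TActModule.ofPS _ _ 1)) *
          PowerSeries.C (g c : PowerSeries 𝒪[F]) - PowerSeries.C ((n c : ℕ) : PowerSeries 𝒪[F])) * L) :
    (colemanImageSubmodule₁ hd hπ E hmono hE hdeg hσ₀ hq u hu γ hθ hcoh hN C hC hCsub h1 hmul hinv hgal).map
        (colemanDeltaCoinvFun hπ hq (intBase F) u hu γ (eq_zero_of_C_pi_mul_eq_zero_integer hπ) w hγ ε) ≤
      Ideal.span {L} * Ideal.span (Set.range fun c =>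
        colemanDeltaCoinvFun hπ hq (intBase F) u hu γ (eq_zero_of_C_pi_mul_eq_zero_integer hπ) w hγ ε
            (unitTwistₗ hπ hq (intBase F) u hu γ (lubinTateChar hπ (σ c)) (TActModule.ofPS _ _ 1)) *
          PowerSeries.C (g c : PowerSeries 𝒪[F]) - PowerSeries.C ((n c : ℕ) : PowerSeries 𝒪[F])) := by
  haveI : CompactSpace (PowerSeries 𝒪[F]) := PowerSeries.WithPiTopology.compactSpace _
  haveI : CompactSpace (PowerSeries (PowerSeries 𝒪[F])) := PowerSeries.WithPiTopology.compactSpace _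
  refine Submodule.map_le_of_subset_closure _ (continuous_colemanDeltaCoinvFun_intBase hπ hq u hu γ w hγ ε)
    (AddSubgroup.mapsTo_closure_range_of_forall_mem _
      (fun c => colemanImage hd hπ E hmono hE hdeg hσ₀ hq u hu γ hθ hcoh (hCsub (hβC c)).1 default) _ fun c => ?_)
    (Ideal.isClosed_of_isNoetherianRing _) _
    (colemanImageSubmodule₁_subset_closure hd hπ E hmono hE hdeg hσ₀ hq u hu γ hθ hcoh hN C hC hCsub h1 hmul hinv hgal β hβC hCgen)
  rw [hL c]
  exact Ideal.mul_mem_mul_rev (Ideal.mem_span_singleton_self L) (Ideal.subset_span (Set.mem_range_self (f := fun c =>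
    colemanDeltaCoinvFun hπ hq (intBase F) u hu γ (eq_zero_of_C_pi_mul_eq_zero_integer hπ) w hγ ε
        (unitTwistₗ hπ hq (intBase F) u hu γ (lubinTateChar hπ (σ c)) (TActModule.ofPS _ _ 1)) *
      PowerSeries.C (g c : PowerSeries 𝒪[F]) - PowerSeries.C ((n c : ℕ) : PowerSeries 𝒪[F])) c))

include hdeg hE hσ₀ hcoh hm h1 hmul hinv hβC in
/-- ★★★ **THE LOCAL (c)-IDENTITY FOR GALOIS-INDEXED FAMILIES, closure form** (`q = 2`, one prime, `d = 1`, `ε`-part): `C` a closed `Γ_F`-stable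
subgroup of `𝒰¹_∞` inside `closure ⟨β_c^{±1}⟩`; indices `σ̃_c ∈ Γ_F` with Amice units `g_c` (ARBITRARY action on `E_∞`); `χ_π(σ̃_{a₁}) = γ`,
`π ∣ n_{a₁} − 1`; ONE `a₂` with non-zero Weierstrass value at `b = n_{a₁} g_{a₁}⁻¹ − 1`; `L_ε ≠ 0` with `φ_ε(Col β_c) = (t_{χ(σ̃_c)}·C g_c − C n_c)·L_ε`.
Then **`char_Λ ((N / Col C)_ε) = (L_ε)`**, `N = Col(𝒰¹_∞)`, `Λ = 𝒪_F⟦X⟧⟦T⟧`. [cite: deShalit1987, III §1.4 (5), Cor. 1.5 (7), Lemma 1.10 (17); II §4.12, §4.14]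
[cite: Washington1997, §13.2] [cite: Matsumura1987, Thm. 20.3] -/
theorem charIdeal_coinvariants_colemanImage_eq_span_of_galois (hε : ε * ε = 1)
    (hCgen : C ⊆ closure (Submonoid.closure (Set.range β ∪ Set.range fun c => fun m => ((β c) m).inv hπ (E m)) : Set _))
    (a₁ a₂ : I) (hv₁ : lubinTateChar hπ (σ a₁) = γ)
    (hn₁ : ((n a₁ : ℕ) : PowerSeries 𝒪[F]) * ((g a₁)⁻¹ : (PowerSeries 𝒪[F])ˣ) - 1 ∈ IsLocalRing.maximalIdeal (PowerSeries 𝒪[F]))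
    (ha₂ : maxEval hn₁ (colemanDeltaCoinvFun hπ hq (intBase F) u hu γ (eq_zero_of_C_pi_mul_eq_zero_integer hπ) w hγ ε
        (unitTwistₗ hπ hq (intBase F) u hu γ (lubinTateChar hπ (σ a₂)) (TActModule.ofPS _ _ 1)) -
      PowerSeries.C (((n a₂ : ℕ) : PowerSeries 𝒪[F]) * ((g a₂)⁻¹ : (PowerSeries 𝒪[F])ˣ))) ≠ 0)
    (L : PowerSeries (PowerSeries 𝒪[F])) (hL0 : L ≠ 0)
    (hL : ∀ c : I, colemanDeltaCoinvFun hπ hq (intBase F) u hu γ (eq_zero_of_C_pi_mul_eq_zero_integer hπ) w hγ ε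
        (colemanImage hd hπ E hmono hE hdeg hσ₀ hq u hu γ hθ hcoh (hCsub (hβC c)).1 default) =
      (colemanDeltaCoinvFun hπ hq (intBase F) u hu γ (eq_zero_of_C_pi_mul_eq_zero_integer hπ) w hγ ε
          (unitTwistₗ hπ hq (intBase F) u hu γ (lubinTateChar hπ (σ c)) (TActModule.ofPS _ _ 1)) *
          PowerSeries.C (g c : PowerSeries 𝒪[F]) - PowerSeries.C ((n c : ℕ) : PowerSeries 𝒪[F])) * L) :
    Module.charIdeal (PowerSeries (PowerSeries 𝒪[F]))
        (↥(unitsImage₁ hd hπ E hmono hE hdeg hσ₀ hq u hu γ hθ hcoh hI hud) ⧸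
          colemanCoinvRel hπ hq (intBase F) u hu γ ε (unitsImage₁ hd hπ E hmono hE hdeg hσ₀ hq u hu γ hθ hcoh hI hud)
            (fun _ hG => unitTwistₗ_mem_unitsImage₁ hd hπ E hmono hE hdeg hσ₀ hq u hu γ hθ hcoh hI hud (-1) hG)
            (colemanImageSubmodule₁ hd hπ E hmono hE hdeg hσ₀ hq u hu γ hθ hcoh hN C hC hCsub h1 hmul hinv hgal)) =
      Ideal.span {L} := by
  have hJ := isPseudoNull_quotient_span_twistFactors hπ hq (intBase F) u hu γ (eq_zero_of_C_pi_mul_eq_zero_integer hπ) w hγ ε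
    (fun c => lubinTateChar hπ (σ c)) g (fun c => ((n c : ℕ) : PowerSeries 𝒪[F])) a₁ a₂ hv₁ hn₁ ha₂
  rw [← charIdeal_lambda₂_quotient_span_singleton hL0]
  exact charIdeal_colemanCoinvariants_eq_of_sandwich_of_isPseudoNull hπ hq (intBase F) u hu γ
    (eq_zero_of_C_pi_mul_eq_zero_integer hπ) w hγ ε hε (fun c => colemanImage hd hπ E hmono hE hdeg hσ₀ hq u hu γ hθ hcoh (hCsub (hβC c)).1 default)
    (fun c => colemanDeltaCoinvFun hπ hq (intBase F) u hu γ (eq_zero_of_C_pi_mul_eq_zero_integer hπ) w hγ ε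
        (unitTwistₗ hπ hq (intBase F) u hu γ (lubinTateChar hπ (σ c)) (TActModule.ofPS _ _ 1)) *
      PowerSeries.C (g c : PowerSeries 𝒪[F]) - PowerSeries.C ((n c : ℕ) : PowerSeries 𝒪[F]))
    L hL0 hL hJ _ _ (Submodule.span_le.mpr (Set.range_subset_iff.mpr fun c => Submodule.mem_map.mpr
      ⟨_, (mem_colemanImageSubmodule hd hπ E hmono hE hdeg hσ₀ hq u hu γ hθ hcoh).mpr
        (colemanImage_mem_colemanImageSet hd hπ E hmono hE hdeg hσ₀ hq u hu γ hθ hcoh (hCsub (hβC c)) (hβC c)), funUnique_coe_apply hπ hq u hu γ _⟩))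
    (map_colemanImageSubmodule₁_le_of_galois hd hπ E hmono hE hdeg hσ₀ hq u hu γ w hγ hθ hcoh hN C hC hCsub h1 hmul hinv hgal β hβC ε σ g n
      hCgen L hL)
    (colemanImageSubmodule₁_le_unitsImage₁ hd hπ E hmono hE hdeg hσ₀ hq u hu γ hθ hcoh hI hud hm hN C hC hCsub h1 hmul hinv hgal) _
    (isPseudoNull_quotient_unitsImage₁ hd hπ E hmono hE hdeg hσ₀ hq u hu γ hθ hcoh hI hud hm)

include hdeg hE hσ₀ hcoh hm h1 hmul hinv hβC in
/-- ★★ **Existence form** (closure frame): from the LEVELWISE relation `(σ̃_c·β_{a,m})·β_{c,m}^{n_a} = (σ̃_a·β_{c,m})·β_{a,m}^{n_c}` for ARBITRARY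
`σ̃_c ∈ Γ_F` with Amice pairs `(g_c, s_c)`, `χ_π(σ̃_{a₁}) = γ`, `π ∣ n_{a₁} − 1` and one auxiliary `a₂`: THE series `L_ε` exists,
`φ_ε(Col β_c) = (t_{χ(σ̃_c)}·C g_c − C n_c)·L_ε`, and — if `L_ε ≠ 0` — **`char_Λ ((N / Col C)_ε) = (L_ε)`**.
[cite: deShalit1987, II §2.4 (ii), §4.12 (29)–(33), §4.14; III §1.4 (5), Lemma 1.10 (17)] [cite: Matsumura1987, Thm. 20.3] -/
theorem exists_charIdeal_coinvariants_colemanImage_eq_span_of_galois (hε : ε * ε = 1)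
    (hCgen : C ⊆ closure (Submonoid.closure (Set.range β ∪ Set.range fun c => fun m => ((β c) m).inv hπ (E m)) : Set _))
    (s : I → ZMod d)
    (hg : ∀ i m, ∃ a : ℕ, (∀ x : E m, σ i • (x : AlgebraicClosure F) = (σ₀ ^ a) • (x : AlgebraicClosure F)) ∧
      ((1 + PowerSeries.X : PowerSeries 𝒪[F]) ^ p ^ m - 1) ∣ (g i : PowerSeries 𝒪[F]) - (1 + PowerSeries.X) ^ a ∧ (a : ZMod d) = s i)
    (hrel : ∀ (a c : I) (m : ℕ), ((β a) m).galAct (σ c) * (β c) m ^ n a = ((β c) m).galAct (σ a) * (β a) m ^ n c)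
    (a₁ a₂ : I) (hv₁ : lubinTateChar hπ (σ a₁) = γ) (hn₁ : (π : 𝒪[F]) ∣ (n a₁ : 𝒪[F]) - 1)
    (ha₂ : maxEval (natCast_mul_inv_sub_one_mem_maximalIdeal hπ hn₁ (g a₁) (constantCoeff_eq_one_of_amice E (p := p) (hg a₁)))
      (colemanDeltaCoinvFun hπ hq (intBase F) u hu γ (eq_zero_of_C_pi_mul_eq_zero_integer hπ) w hγ ε
          (unitTwistₗ hπ hq (intBase F) u hu γ (lubinTateChar hπ (σ a₂)) (TActModule.ofPS _ _ 1)) -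
        PowerSeries.C (((n a₂ : ℕ) : PowerSeries 𝒪[F]) * ((g a₂)⁻¹ : (PowerSeries 𝒪[F])ˣ))) ≠ 0) :
    ∃ L : PowerSeries (PowerSeries 𝒪[F]),
      (∀ c : I, colemanDeltaCoinvFun hπ hq (intBase F) u hu γ (eq_zero_of_C_pi_mul_eq_zero_integer hπ) w hγ ε
          (colemanImage hd hπ E hmono hE hdeg hσ₀ hq u hu γ hθ hcoh (hCsub (hβC c)).1 default) =
        (colemanDeltaCoinvFun hπ hq (intBase F) u hu γ (eq_zero_of_C_pi_mul_eq_zero_integer hπ) w hγ ε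
            (unitTwistₗ hπ hq (intBase F) u hu γ (lubinTateChar hπ (σ c)) (TActModule.ofPS _ _ 1)) *
            PowerSeries.C (g c : PowerSeries 𝒪[F]) - PowerSeries.C ((n c : ℕ) : PowerSeries 𝒪[F])) * L) ∧
      (L ≠ 0 → Module.charIdeal (PowerSeries (PowerSeries 𝒪[F]))
          (↥(unitsImage₁ hd hπ E hmono hE hdeg hσ₀ hq u hu γ hθ hcoh hI hud) ⧸
            colemanCoinvRel hπ hq (intBase F) u hu γ ε (unitsImage₁ hd hπ E hmono hE hdeg hσ₀ hq u hu γ hθ hcoh hI hud)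
              (fun _ hG => unitTwistₗ_mem_unitsImage₁ hd hπ E hmono hE hdeg hσ₀ hq u hu γ hθ hcoh hI hud (-1) hG)
              (colemanImageSubmodule₁ hd hπ E hmono hE hdeg hσ₀ hq u hu γ hθ hcoh hN C hC hCsub h1 hmul hinv hgal)) =
        Ideal.span {L}) := by
  obtain ⟨L, hL, -⟩ := existsUnique_colemanDeltaCoinvFun_colemanImageCoh_eq_twistMul hd hπ E hmono hE hdeg hσ₀ hq u hu γ w hγ ε hε hθ hcoh
    (fun c => (⟨β c, (hCsub (hβC c)).1⟩ : coherentFamilies hπ E hmono)) σ g s hg n hrel a₁ a₂ hv₁ hn₁ ha₂ default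
  exact ⟨L, hL, fun hL0 => charIdeal_coinvariants_colemanImage_eq_span_of_galois hd hπ E hmono hE hdeg hσ₀ hq u hu γ w hγ hθ hcoh hI hud hm hN C
    hC hCsub h1 hmul hinv hgal β hβC ε σ g n hε hCgen a₁ a₂ hv₁ _ ha₂ L hL0 hL⟩

end Galois

/-! ## §4. The generated form `𝒞̄ = closure ⟨β_c^{±1}⟩` -/

section Generated

attribute [local instance] RelNormCoherentUnits.instCommMonoid
attribute [local instance] isAdicComplete_maximalIdeal_powerSeries_integer

variable {p : ℕ} [hp : Fact p.Prime] {d : ℕ} (hd : d.Coprime p)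
variable {π : 𝒪[F]} (hπ : (valuation F).IsUniformizer (π : F))
variable (E : ℕ → IntermediateField F (AlgebraicClosure F)) [∀ m, FiniteDimensional F (E m)] [∀ m, Normal F (E m)]
  [∀ m, IsGalois F (E m)] (hmono : Monotone E) (hE : ∀ m, E m ≤ maxUnramified F) (hdeg : ∀ m, Module.finrank F (E m) = d * p ^ m)
  {σ₀ : absoluteGaloisGroup F} (hσ₀ : IsAbsArithFrob σ₀) (hq : residueFieldCard F = 2)
variable (u : (LTCoeff F)ˣ) (hu : LTCoeff.of F π = residueFieldCard F * u) (γ w : 𝒪[F]ˣ) (hγ : (γ : 𝒪[F]) = 1 + π ^ 2 * w)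
variable [IsAdicComplete (Ideal.span {intBase F (LTCoeff.of F π)}) (PowerSeries 𝒪[F])] [NeZero d]
variable {θ : ∀ m, unitBall (E m)} (hθ : ∀ m, IsIntegralNormalGen (E m) (θ m))
  (hcoh : ∀ m, unitBallTrace (hmono (Nat.le_succ m)) (θ (m + 1)) = θ m)
variable [CharZero F] [IsAdicComplete (Ideal.span {(p : 𝒪[F])}) 𝒪[F]] (hI : Ideal.span {(p : 𝒪[F])} ≠ ⊤)
  (hud : ∀ m, (u : LTCoeff F) ^ Module.finrank F (E m) ≠ 1) (hm : ∃ m₁ : ℕ, LTCoeff.of F π ^ 2 ∣ LTCoeff.of F π - m₁)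
variable [Unique (ZMod d)] (hN : DenseRange (Nat.cast : ℕ → 𝒪[F]))
variable {I : Type*} (β : I → ∀ m, RelNormCoherentUnits hπ (E m)) (hβ : ∀ c, β c ∈ principalCoherentFamilies hπ E hmono)
  (hgen : ∀ (τ : absoluteGaloisGroup F) (c : I), (fun m => ((β c) m).galAct τ) ∈
    closure (Submonoid.closure (Set.range β ∪ Set.range fun c => fun m => ((β c) m).inv hπ (E m)) : Set (∀ m, RelNormCoherentUnits hπ (E m))))
variable (ε : PowerSeries (PowerSeries 𝒪[F])) (σ : I → absoluteGaloisGroup F) (g : I → (PowerSeries 𝒪[F])ˣ) (n : I → ℕ)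

include hdeg hE hσ₀ hcoh hm in
/-- ★★★ **THE LOCAL (c)-IDENTITY FOR GALOIS-INDEXED FAMILIES, generated form** (de Shalit III Lemma 1.10 (17) at `q = 2`, one prime, `d = 1`,
`ε`-part): `𝒞̄ = closure ⟨β_c^{±1}⟩` with all Galois translates of the generators in `𝒞̄`; indices `σ̃_c ∈ Γ_F` with Amice units `g_c`
(arbitrary action on `E_∞`); `χ_π(σ̃_{a₁}) = γ`; `b = n_{a₁} g_{a₁}⁻¹ − 1 ∈ 𝔪`; one `a₂`; `L_ε ≠ 0` with
`φ_ε(Col β_c) = (t_{χ(σ̃_c)}·C g_c − C n_c)·L_ε`.  Then **`char_Λ ((N / Col 𝒞̄)_ε) = (L_ε)`**.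
[cite: deShalit1987, III §1.4 (5), Cor. 1.5 (7), Lemma 1.10 (17); II §4.12 (33), §4.14] [cite: Matsumura1987, Thm. 20.3] -/
theorem charIdeal_coinvariants_colemanImage_closure_eq_span_of_galois (hε : ε * ε = 1)
    (a₁ a₂ : I) (hv₁ : lubinTateChar hπ (σ a₁) = γ)
    (hn₁ : ((n a₁ : ℕ) : PowerSeries 𝒪[F]) * ((g a₁)⁻¹ : (PowerSeries 𝒪[F])ˣ) - 1 ∈ IsLocalRing.maximalIdeal (PowerSeries 𝒪[F]))
    (ha₂ : maxEval hn₁ (colemanDeltaCoinvFun hπ hq (intBase F) u hu γ (eq_zero_of_C_pi_mul_eq_zero_integer hπ) w hγ ε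
        (unitTwistₗ hπ hq (intBase F) u hu γ (lubinTateChar hπ (σ a₂)) (TActModule.ofPS _ _ 1)) -
      PowerSeries.C (((n a₂ : ℕ) : PowerSeries 𝒪[F]) * ((g a₂)⁻¹ : (PowerSeries 𝒪[F])ˣ))) ≠ 0)
    (L : PowerSeries (PowerSeries 𝒪[F])) (hL0 : L ≠ 0)
    (hL : ∀ c : I, colemanDeltaCoinvFun hπ hq (intBase F) u hu γ (eq_zero_of_C_pi_mul_eq_zero_integer hπ) w hγ ε
        (colemanImage hd hπ E hmono hE hdeg hσ₀ hq u hu γ hθ hcoh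
          (closure_unitsGen_subset_principalCoherentFamilies hπ E hmono β hβ (mem_closure_unitsGen hπ E β c)).1 default) =
      (colemanDeltaCoinvFun hπ hq (intBase F) u hu γ (eq_zero_of_C_pi_mul_eq_zero_integer hπ) w hγ ε
          (unitTwistₗ hπ hq (intBase F) u hu γ (lubinTateChar hπ (σ c)) (TActModule.ofPS _ _ 1)) *
          PowerSeries.C (g c : PowerSeries 𝒪[F]) - PowerSeries.C ((n c : ℕ) : PowerSeries 𝒪[F])) * L) :
    Module.charIdeal (PowerSeries (PowerSeries 𝒪[F]))
        (↥(unitsImage₁ hd hπ E hmono hE hdeg hσ₀ hq u hu γ hθ hcoh hI hud) ⧸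
          colemanCoinvRel hπ hq (intBase F) u hu γ ε (unitsImage₁ hd hπ E hmono hE hdeg hσ₀ hq u hu γ hθ hcoh hI hud)
            (fun _ hG => unitTwistₗ_mem_unitsImage₁ hd hπ E hmono hE hdeg hσ₀ hq u hu γ hθ hcoh hI hud (-1) hG)
            (colemanImageSubmodule₁ hd hπ E hmono hE hdeg hσ₀ hq u hu γ hθ hcoh hN
              (closure (Submonoid.closure (Set.range β ∪ Set.range fun c => fun m => ((β c) m).inv hπ (E m)) :
                Set (∀ m, RelNormCoherentUnits hπ (E m))))
              isClosed_closure (closure_unitsGen_subset_principalCoherentFamilies hπ E hmono β hβ) (one_mem_closure_unitsGen hπ E β)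
              (mul_mem_closure_unitsGen hπ E β) (inv_mem_closure_unitsGen hπ E β) (galAct_mem_closure_unitsGen hπ E β hgen))) =
      Ideal.span {L} :=
  charIdeal_coinvariants_colemanImage_eq_span_of_galois hd hπ E hmono hE hdeg hσ₀ hq u hu γ w hγ hθ hcoh hI hud hm hN _ isClosed_closure
    (closure_unitsGen_subset_principalCoherentFamilies hπ E hmono β hβ) (one_mem_closure_unitsGen hπ E β)
    (mul_mem_closure_unitsGen hπ E β) (inv_mem_closure_unitsGen hπ E β) (galAct_mem_closure_unitsGen hπ E β hgen) β
    (mem_closure_unitsGen hπ E β) ε σ g n hε subset_rfl a₁ a₂ hv₁ hn₁ ha₂ L hL0 hL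

include hdeg hE hσ₀ hcoh hm in
/-- ★★ **Existence form, generated**: under the LEVELWISE relation for arbitrary Galois indices (II §2.4 (ii) with local lifts of the Artin symbols)
and the two auxiliary indices, THE series `L_ε` exists with `φ_ε(Col β_c) = (t_{χ(σ̃_c)}·C g_c − C n_c)·L_ε`, and — if `L_ε ≠ 0` —
**`char_Λ ((N / Col 𝒞̄)_ε) = (L_ε)`**. [cite: deShalit1987, II §2.4 (ii), §4.12 (29)–(33), §4.14; III §1.4 (5), Lemma 1.10 (17)] [cite: Matsumura1987, Thm. 20.3] -/
theorem exists_charIdeal_coinvariants_colemanImage_closure_eq_span_of_galois (hε : ε * ε = 1) (s : I → ZMod d)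
    (hg : ∀ i m, ∃ a : ℕ, (∀ x : E m, σ i • (x : AlgebraicClosure F) = (σ₀ ^ a) • (x : AlgebraicClosure F)) ∧
      ((1 + PowerSeries.X : PowerSeries 𝒪[F]) ^ p ^ m - 1) ∣ (g i : PowerSeries 𝒪[F]) - (1 + PowerSeries.X) ^ a ∧ (a : ZMod d) = s i)
    (hrel : ∀ (a c : I) (m : ℕ), ((β a) m).galAct (σ c) * (β c) m ^ n a = ((β c) m).galAct (σ a) * (β a) m ^ n c)
    (a₁ a₂ : I) (hv₁ : lubinTateChar hπ (σ a₁) = γ) (hn₁ : (π : 𝒪[F]) ∣ (n a₁ : 𝒪[F]) - 1)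
    (ha₂ : maxEval (natCast_mul_inv_sub_one_mem_maximalIdeal hπ hn₁ (g a₁) (constantCoeff_eq_one_of_amice E (p := p) (hg a₁)))
      (colemanDeltaCoinvFun hπ hq (intBase F) u hu γ (eq_zero_of_C_pi_mul_eq_zero_integer hπ) w hγ ε
          (unitTwistₗ hπ hq (intBase F) u hu γ (lubinTateChar hπ (σ a₂)) (TActModule.ofPS _ _ 1)) -
        PowerSeries.C (((n a₂ : ℕ) : PowerSeries 𝒪[F]) * ((g a₂)⁻¹ : (PowerSeries 𝒪[F])ˣ))) ≠ 0) :
    ∃ L : PowerSeries (PowerSeries 𝒪[F]),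
      (∀ c : I, colemanDeltaCoinvFun hπ hq (intBase F) u hu γ (eq_zero_of_C_pi_mul_eq_zero_integer hπ) w hγ ε
          (colemanImage hd hπ E hmono hE hdeg hσ₀ hq u hu γ hθ hcoh
            (closure_unitsGen_subset_principalCoherentFamilies hπ E hmono β hβ (mem_closure_unitsGen hπ E β c)).1 default) =
        (colemanDeltaCoinvFun hπ hq (intBase F) u hu γ (eq_zero_of_C_pi_mul_eq_zero_integer hπ) w hγ ε
            (unitTwistₗ hπ hq (intBase F) u hu γ (lubinTateChar hπ (σ c)) (TActModule.ofPS _ _ 1)) *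
            PowerSeries.C (g c : PowerSeries 𝒪[F]) - PowerSeries.C ((n c : ℕ) : PowerSeries 𝒪[F])) * L) ∧
      (L ≠ 0 → Module.charIdeal (PowerSeries (PowerSeries 𝒪[F]))
          (↥(unitsImage₁ hd hπ E hmono hE hdeg hσ₀ hq u hu γ hθ hcoh hI hud) ⧸
            colemanCoinvRel hπ hq (intBase F) u hu γ ε (unitsImage₁ hd hπ E hmono hE hdeg hσ₀ hq u hu γ hθ hcoh hI hud)
              (fun _ hG => unitTwistₗ_mem_unitsImage₁ hd hπ E hmono hE hdeg hσ₀ hq u hu γ hθ hcoh hI hud (-1) hG)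
              (colemanImageSubmodule₁ hd hπ E hmono hE hdeg hσ₀ hq u hu γ hθ hcoh hN
                (closure (Submonoid.closure (Set.range β ∪ Set.range fun c => fun m => ((β c) m).inv hπ (E m)) :
                  Set (∀ m, RelNormCoherentUnits hπ (E m))))
                isClosed_closure (closure_unitsGen_subset_principalCoherentFamilies hπ E hmono β hβ) (one_mem_closure_unitsGen hπ E β)
                (mul_mem_closure_unitsGen hπ E β) (inv_mem_closure_unitsGen hπ E β) (galAct_mem_closure_unitsGen hπ E β hgen))) =
        Ideal.span {L}) :=
  exists_charIdeal_coinvariants_colemanImage_eq_span_of_galois hd hπ E hmono hE hdeg hσ₀ hq u hu γ w hγ hθ hcoh hI hud hm hN _ isClosed_closure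
    (closure_unitsGen_subset_principalCoherentFamilies hπ E hmono β hβ) (one_mem_closure_unitsGen hπ E β)
    (mul_mem_closure_unitsGen hπ E β) (inv_mem_closure_unitsGen hπ E β) (galAct_mem_closure_unitsGen hπ E β hgen) β
    (mem_closure_unitsGen hπ E β) ε σ g n hε subset_rfl s hg hrel a₁ a₂ hv₁ hn₁ ha₂

end Generated

end Summit.BirchSwinnertonDyer.BirchSwinnertonDyer.Theorems.PrintCf2.ColemanCoinvariantGalois

end
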